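import Summits.HodgeConjecture.CorCM.MumfordTateRankProductsOfCurves
import Summits.HodgeConjecture.CorCM.MumfordTateRankSurfaceTimesTwoCurves
import Summits.HodgeConjecture.CorCM.MumfordTateRankCMCurvesSurfacesProducts
import HarnessLib

/-!
# Simple abelian SURFACE × any number of elliptic CURVES: `t(S × E₀ × ⋯ × E_m) = t(S) + 3a + b` — uniformly for CM and non-CM `S`
# (`a`, `b` the numbers of isogeny classes of the non-CM / CM curves; Moonen–Zarhin 1999 §3, (5.4))

COR-CM (cell `pub-hodgecm2`, seat `b27` gen 49, count-neutral Mumford–Tate-rank ladder; theorems only, no definition, no named fact;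
UNCONDITIONAL — nothing here uses or asserts HC_CM).  Notation `t(X) = dim MT(H¹X)`.

For `X ∼ S × ⨁_j E_j` with `S` a SIMPLE abelian surface and `E_j` elliptic curves (any isogenies, any multiplicities):
* `S` not of CM type: `Hom(⨁ E, S) = 0`, so `t(X) + 1 = t(S) + t(⨁ E)` (Moonen–Zarhin (5.4)) and `t(⨁ E) = 3a + b + 1`
  (`CorCM/MumfordTateRankProductsOfCurves`);
* `S` of CM type (`t(S) = 3`): with the CM curves `K` and the non-CM curves `N`, `X ∼ N × (S × K)`, `t + 1 = t(N) + t(S × K)` (Thm. (3.2)(2)),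
  `t(N) = 3a + 1`, and `t(S × K) = b + 3` (`exists_mtRank_hodge_one_eq_of_cmSurface_prod_biproduct_cmCurves`: one surface slot and the isogeny
  classes of the curves, `CorCM/MumfordTateRankCMCurvesSurfacesProducts`);
so in all cases **`t(X) = t(S) + 3a + b`** (`exists_mtRank_hodge_one_eq_of_isIsogenous_simpleSurface_prod_biproduct_curves`), `t(S) ∈ {3, 4, 7, 11}`.
Tables: the fivefold partition `{2,1,1,1}` — `t(S × E₀ × E₁ × E₂) ∈ {4, …, 18, 20}` — and `t(S × E₀ × ⋯ × E_m) ≤ 3m + 14`.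

## References
* [MoonenZarhin1999LowDim] B. Moonen, Yu. G. Zarhin, *Hodge classes on abelian varieties of low dimension*, Math. Ann. 315 (1999), §2 (2.2), §3 Thm. (3.2)(2),
  (3.4), (3.8), §5 (5.4) [corpus: paper:arxiv-math_9901113 pp. 5–7, 10]. [cite: MoonenZarhin1999LowDim, §3 (3.4) and §5 (5.4)]
* [Gordon1999HodgeAVSurvey] B. B. Gordon, *A survey of the Hodge conjecture for abelian varieties*, §3 Theorem (Imai), 7.5–7.7. [cite: Gordon1999HodgeAVSurvey, 7.5 and 7.6.1]
* [MumfordAV1970] D. Mumford, *Abelian Varieties* (1970), §19 Thm. 1, Cor. 2. [cite: MumfordAV1970, §19 Cor. 2 of Thm. 1]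
-/

noncomputable section

open CategoryTheory CategoryTheory.Limits Module
open scoped BigOperators

namespace Summit.HodgeConjecture.CorCM

open Literature.AlgebraicGeometry.Motives
open Literature.AlgebraicGeometry.Motives.AbelianVariety
open Literature.AlgebraicGeometry.Motives.HodgeStructure
open Literature.AlgebraicGeometry.HodgeTheory
open Literature.AlgebraicGeometry.Milne1999 (IsOfCMType isOfCMType_iff_of_isIsogenous isOfCMType_prod_iff hom_eq_zero_of_isSimple_of_not_isIsogenous
  isIsogeny_biproduct_map)

variable [HodgeTensorFacts.{0, 0}] {X : AbelianVariety ℂ} {n : ℕ}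

/-! ## §1 Simple CM surface × CM curves with repetitions: `t = b + 3` -/

/-- **`t(S × ⨁_j E_j) = b + 3` for a simple CM surface `S` and CM elliptic curves `E_j`** (`b` the number of their isogeny classes, `1 ≤ b ≤ m + 1`):
the family «`S` and one representative per isogeny class» has one surface slot, so `t = Σ dim + 1 = (2 + b) + 1`
(`mtRank_hodge_one_eq_and_isDivisorGenerated_of_isIsogenous_biproduct_cmCurves_cmSurfaces`). [cite: MoonenZarhin1999LowDim, §3 (3.1) and (3.4)]
[cite: Gordon1999HodgeAVSurvey, 7.5 and 7.6.1] -/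
theorem exists_mtRank_hodge_one_eq_of_cmSurface_prod_biproduct_cmCurves {m : ℕ} (hX : IsSmoothProjective n X.X) {S : AbelianVariety ℂ}
    {E : Fin (m + 1) → AbelianVariety ℂ} (hSs : S.IsSimple) (hS2 : S.dim = 2) (hScm : IsOfCMType S) (hE1 : ∀ j, (E j).dim = 1)
    (hcm : ∀ j, IsOfCMType (E j)) (hXP : IsIsogenous X (S.prod (⨁ E))) :
    haveI := BettiUniverse.finite hX 1
    ∃ b : ℕ, 1 ≤ b ∧ b ≤ m + 1 ∧ (BettiUniverse.hodge exists_isReal_hodgeModel_holds hX 1).mtRank = b + 3 := by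
  classical
  haveI := BettiUniverse.finite hX 1
  -- isogeny classes of the curves and representatives
  let r : Setoid (Fin (m + 1)) :=
    ⟨fun i j => IsIsogenous (E i) (E j), ⟨fun _ => IsIsogenous.refl _, fun h => h.symm', fun h h' => h.trans h'⟩⟩
  let cls' : Fin (m + 1) → Quotient r := Quotient.mk r
  let R : Quotient r → AbelianVariety ℂ := fun c => E c.out
  have hcls' : Function.Surjective cls' := fun c => ⟨c.out, c.out_eq⟩
  have hrel : ∀ j, IsIsogenous (E j) (R (cls' j)) := fun j => by
    have h : r.r (cls' j).out j := Quotient.exact (cls' j).out_eq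
    exact IsIsogenous.symm' h
  have hRniso : ∀ c c', c ≠ c' → ¬ IsIsogenous (R c) (R c') := fun c c' hne h =>
    hne (by rw [← c.out_eq, ← c'.out_eq]; exact Quotient.sound h)
  have hR1 : ∀ c, (R c).dim = 1 := fun c => hE1 _
  -- the family «`S` and the representatives», indexed by `Option`
  let F : Option (Quotient r) → AbelianVariety ℂ := fun o => o.elim S R
  let cls : Fin (m + 2) → Option (Quotient r) := Fin.cons none (fun j => some (cls' j))
  have hcls : Function.Surjective cls := by
    rintro (_ | c)
    · exact ⟨0, rfl⟩
    · obtain ⟨j, rfl⟩ := hcls' c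
      exact ⟨j.succ, by simp only [cls, Fin.cons_succ]⟩
  -- `X ∼ S × ⨁_j R_{cls' j} ∼ ⨁_j F_{cls j}`
  choose g hg using hrel
  have hXP' : IsIsogenous X (S.prod (⨁ fun j => R (cls' j))) :=
    hXP.trans ((IsIsogenous.refl S).prod ⟨biproduct.map g, isIsogeny_biproduct_map hg⟩)
  obtain ⟨h, g', hhg, hgh⟩ := AndreRiemann.biproduct_succ_split (fun j => F (cls j))
  have hh : IsIsogeny h := isIsogeny_of_comp_eq_of_comp_eq (isIsogeny_id _) (isIsogeny_id _) hgh hhg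
  have hsucc : (fun j => F (cls j)) ∘ Fin.succ = fun j => R (cls' j) := funext fun j => by
    simp only [Function.comp_apply, cls, Fin.cons_succ]
    rfl
  have h1 : IsIsogenous (⨁ fun j => F (cls j)) (S.prod (⨁ ((fun j => F (cls j)) ∘ Fin.succ))) := ⟨h, hh⟩
  rw [hsucc] at h1
  have hXB : IsIsogenous X (⨁ fun j => F (cls j)) := hXP'.trans h1.symm'
  -- hypotheses of the census
  have hFs : ∀ o, (F o).IsSimple := by
    rintro (_ | c)
    · exact hSs
    · exact isSimple_of_dim_le_one (A := R c) (hR1 c).le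
  have hFcm : ∀ o, IsOfCMType (F o) := by
    rintro (_ | c)
    · exact hScm
    · exact hcm _
  have hF12 : ∀ o, (F o).dim = 1 ∨ (F o).dim = 2 := by
    rintro (_ | c)
    · exact Or.inr hS2
    · exact Or.inl (hR1 c)
  have hd2 : ∀ o, (F o).dim = 2 → o = none := by
    rintro (_ | c) h
    · rfl
    · exact absurd ((hR1 c).symm.trans h) (by norm_num)
  have hFniso : ∀ o o', o ≠ o' → ¬ IsIsogenous (F o) (F o') := by
    rintro (_ | c) (_ | c') hne hiso
    · exact hne rfl
    · have hd : S.dim = (R c').dim := dim_eq_of_isIsogenous_holds hiso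
      rw [hS2, hR1] at hd
      omega
    · have hd : (R c).dim = S.dim := dim_eq_of_isIsogenous_holds hiso
      rw [hS2, hR1] at hd
      omega
    · exact hRniso c c' (fun h => hne (congrArg some h)) hiso
  have h3 : ∀ i j k : Option (Quotient r), i ≠ j → j ≠ k → i ≠ k → (F i).dim = 2 → (F j).dim = 2 → (F k).dim ≠ 2 :=
    fun i j _ hij _ _ hi hj _ => hij ((hd2 i hi).trans (hd2 j hj).symm)
  have ht := (mtRank_hodge_one_eq_and_isDivisorGenerated_of_isIsogenous_biproduct_cmCurves_cmSurfaces hFs hFcm hF12 hFniso h3 hcls hX hXB).1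
  rw [Fintype.sum_option] at ht
  refine ⟨Fintype.card (Quotient r), Fintype.card_pos_iff.2 ⟨cls' 0⟩, by simpa using Fintype.card_le_of_surjective cls' hcls', ?_⟩
  rw [ht]
  simp only [F, Option.elim, hR1, Finset.sum_const, Finset.card_univ, smul_eq_mul, mul_one, hS2]
  ring

/-! ## §2 Simple surface × arbitrary curves: `t = t(S) + 3a + b` -/

/-- **`t(S × E₀ × ⋯ × E_m) = t(S) + 3a + b` for EVERY simple abelian surface `S` and arbitrary elliptic curves `E_j`** (`a`, `b` the numbers of
isogeny classes of the non-CM / CM curves; `1 ≤ a + b ≤ m + 1`, `a = 0` iff all CM, `b = 0` iff none).  Non-CM `S`: `Hom(⨁ E, S) = 0` and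
(5.4); CM `S`: `X ∼ N × (S × K)` with `N` the non-CM and `K` the CM curves, Thm. (3.2)(2), §1. [cite: MoonenZarhin1999LowDim, §3 (3.4) and §5 (5.4)]
[cite: Gordon1999HodgeAVSurvey, 7.5 and 7.6.1] [cite: MumfordAV1970, §19 Cor. 2 of Thm. 1] -/
theorem exists_mtRank_hodge_one_eq_of_isIsogenous_simpleSurface_prod_biproduct_curves {m : ℕ} (hX : IsSmoothProjective n X.X)
    {S : AbelianVariety ℂ} {E : Fin (m + 1) → AbelianVariety ℂ} (hSs : S.IsSimple) (hS2 : S.dim = 2) (hE1 : ∀ j, (E j).dim = 1)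
    (hXP : IsIsogenous X (S.prod (⨁ E))) :
    haveI := BettiUniverse.finite hX 1
    haveI := BettiUniverse.finite (AbelianVariety.isSmoothProjective_holds (A := S)) 1
    ∃ a b : ℕ, 1 ≤ a + b ∧ a + b ≤ m + 1 ∧
      (BettiUniverse.hodge exists_isReal_hodgeModel_holds hX 1).mtRank =
        (BettiUniverse.hodge exists_isReal_hodgeModel_holds (AbelianVariety.isSmoothProjective_holds (A := S)) 1).mtRank + 3 * a + b ∧
      (a = 0 ↔ ∀ j, IsOfCMType (E j)) ∧ (b = 0 ↔ ∀ j, ¬ IsOfCMType (E j)) := by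
  classical
  have hS := AbelianVariety.isSmoothProjective_holds (A := S)
  have hP := AbelianVariety.isSmoothProjective_holds (A := ⨁ E)
  haveI := BettiUniverse.finite hX 1
  haveI := BettiUniverse.finite hS 1
  haveI := BettiUniverse.finite hP 1
  have hP0 : 0 < (⨁ E).dim := by
    rw [AndreRiemann.dim_biproduct_fin]
    exact Finset.sum_pos (fun j _ => by rw [hE1]; exact one_pos) Finset.univ_nonempty
  by_cases hScm : IsOfCMType S
  swap
  · -- non-CM surface: `t(X) + 1 = t(⨁ E) + t(S)`
    have hAS : ∀ u : (⨁ E) ⟶ S, u = 0 := fun u => biproduct.hom_ext' _ _ fun j => by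
      rw [comp_zero]
      exact forall_hom_curve_simpleSurface_eq_zero (hE1 j) hSs hS2 _
    have h := mtRank_hodge_one_add_one_eq_add_of_isIsogenous_prod_simpleSurface_of_not_isOfCMType hX hP hS hP0 hSs hS2 hScm hAS
      (hXP.trans (Literature.AlgebraicGeometry.HodgeTheory.isIsogenous_prod_comm S (⨁ E)))
    obtain ⟨a, b, h1, hm, ht, ha, hb⟩ := exists_mtRank_hodge_one_eq_of_biproduct_curves hP hE1 (IsIsogenous.refl _)
    exact ⟨a, b, h1, hm, by omega, ha, hb⟩
  -- CM surface: `t(S) = 3`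
  have h3 := (isOfCMType_iff_mtRank_hodge_one_eq_three_of_isSimple_surface hS hSs hS2).1 hScm
  by_cases hall : ∀ j, IsOfCMType (E j)
  · obtain ⟨b, hb1, hbm, ht⟩ := exists_mtRank_hodge_one_eq_of_cmSurface_prod_biproduct_cmCurves hX hSs hS2 hScm hE1 hall hXP
    exact ⟨0, b, by omega, by omega, by omega, ⟨fun _ => hall, fun _ => rfl⟩, ⟨fun h => by omega, fun h => absurd (hall 0) (h 0)⟩⟩
  by_cases hnone : ∀ j, ¬ IsOfCMType (E j)
  · -- `X ∼ (⨁ E) × S`, no factor of type IV × CM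
    have hP4 : HasNoTypeIVFactor (⨁ E) := hasNoTypeIVFactor_biproduct_fin E fun i => (curve_facts_of_not_isOfCMType (hE1 i) (hnone i)).2.2.1
    have h := mtRank_hodge_one_add_one_eq_add_of_isIsogenous_prod hX hP hS hP0 (by omega) hP4 hScm
      (hXP.trans (Literature.AlgebraicGeometry.HodgeTheory.isIsogenous_prod_comm S (⨁ E)))
    obtain ⟨a, ha1, ham, ht⟩ := exists_mtRank_hodge_one_eq_of_biproduct_nonCM_curves hP hE1 hnone (IsIsogenous.refl _)
    exact ⟨a, 0, by omega, by omega, by omega, ⟨fun h => by omega, fun h => absurd (h 0) (hnone 0)⟩, ⟨fun _ => hnone, fun _ => rfl⟩⟩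
  push Not at hall hnone
  obtain ⟨j₁, hj₁⟩ := hall
  obtain ⟨j₂, hj₂⟩ := hnone
  -- split the curves by «CM» and reindex both parts by `Fin`
  let p : Fin (m + 1) → Prop := fun j => IsOfCMType (E j)
  have hsplit := isIsogenous_biproduct_prod_subtype E p
  obtain ⟨mC, hmC⟩ := Nat.exists_eq_succ_of_ne_zero (Fintype.card_pos_iff.2 ⟨(⟨j₂, hj₂⟩ : {j // p j})⟩).ne'
  obtain ⟨mN, hmN⟩ := Nat.exists_eq_succ_of_ne_zero (Fintype.card_pos_iff.2 ⟨(⟨j₁, hj₁⟩ : {j // ¬ p j})⟩).ne'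
  let eC : Fin (mC + 1) ≃ {j // p j} := (finCongr hmC).symm.trans (Fintype.equivFin {j // p j}).symm
  let eN : Fin (mN + 1) ≃ {j // ¬ p j} := (finCongr hmN).symm.trans (Fintype.equivFin {j // ¬ p j}).symm
  let EC : Fin (mC + 1) → AbelianVariety ℂ := (fun j : {j // p j} => E j.1) ∘ eC
  let EN : Fin (mN + 1) → AbelianVariety ℂ := (fun j : {j // ¬ p j} => E j.1) ∘ eN
  have hPC : IsIsogenous (⨁ fun j : {j // p j} => E j.1) (⨁ EC) :=
    ⟨(biproduct.reindex eC (fun j : {j // p j} => E j.1)).inv, isIsogeny_hom_of_iso (biproduct.reindex eC _).symm⟩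
  have hPN : IsIsogenous (⨁ fun j : {j // ¬ p j} => E j.1) (⨁ EN) :=
    ⟨(biproduct.reindex eN (fun j : {j // ¬ p j} => E j.1)).inv, isIsogeny_hom_of_iso (biproduct.reindex eN _).symm⟩
  -- `X ∼ S × (K × N) ∼ (S × K) × N ∼ N × (S × K)`
  have hXQ : IsIsogenous X ((⨁ EN).prod (S.prod (⨁ EC))) :=
    (((hXP.trans ((IsIsogenous.refl S).prod (hsplit.trans (hPC.prod hPN)))).trans
      (Summit.HodgeConjecture.CorCM.isIsogenous_prod_assoc S (⨁ EC) (⨁ EN))).trans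
      (Literature.AlgebraicGeometry.HodgeTheory.isIsogenous_prod_comm (S.prod (⨁ EC)) (⨁ EN)))
  have hN : IsSmoothProjective (⨁ EN).dim (⨁ EN).X := AbelianVariety.isSmoothProjective_holds
  have hSK : IsSmoothProjective (S.prod (⨁ EC)).dim (S.prod (⨁ EC)).X := AbelianVariety.isSmoothProjective_holds
  haveI := BettiUniverse.finite hN 1
  haveI := BettiUniverse.finite hSK 1
  have hEN1 : ∀ i, (EN i).dim = 1 := fun i => hE1 _
  have hEC1 : ∀ i, (EC i).dim = 1 := fun i => hE1 _
  have hENcm : ∀ i, ¬ IsOfCMType (EN i) := fun i => (eN i).2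
  have hECcm : ∀ i, IsOfCMType (EC i) := fun i => (eC i).2
  have hN0 : 0 < (⨁ EN).dim := by
    rw [AndreRiemann.dim_biproduct_fin]
    exact Finset.sum_pos (fun j _ => by rw [hEN1]; exact one_pos) Finset.univ_nonempty
  have hN4 : HasNoTypeIVFactor (⨁ EN) := hasNoTypeIVFactor_biproduct_fin EN fun i => (curve_facts_of_not_isOfCMType (hEN1 i) (hENcm i)).2.2.1
  have hSKcm : IsOfCMType (S.prod (⨁ EC)) := isOfCMType_prod_iff.2 ⟨hScm, RankFourWeil.isOfCMType_biproduct_fin EC hECcm⟩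
  have hsum := mtRank_hodge_one_add_one_eq_add_of_isIsogenous_prod hX hN hSK hN0 (by rw [dim_prod]; omega) hN4 hSKcm hXQ
  obtain ⟨a, ha1, ham, htN⟩ := exists_mtRank_hodge_one_eq_of_biproduct_nonCM_curves hN hEN1 hENcm (IsIsogenous.refl _)
  obtain ⟨b, hb1, hbm, htC⟩ := exists_mtRank_hodge_one_eq_of_cmSurface_prod_biproduct_cmCurves hSK hSs hS2 hScm hEC1 hECcm (IsIsogenous.refl _)
  rw [htN, htC] at hsum
  have hcard : Fintype.card {j // ¬ p j} = Fintype.card (Fin (m + 1)) - Fintype.card {j // p j} := Fintype.card_subtype_compl p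
  have hle : Fintype.card {j // p j} ≤ Fintype.card (Fin (m + 1)) := Fintype.card_subtype_le p
  rw [Fintype.card_fin] at hcard hle
  refine ⟨a, b, by omega, by omega, by omega, ⟨fun h => by omega, fun h => absurd (h j₁) hj₁⟩, ⟨fun h => by omega, fun h => absurd hj₂ (h j₂)⟩⟩

/-! ## §3 Tables -/

/-- **The fivefold partition `{2,1,1,1}`: `t(S × E₀ × E₁ × E₂) ∈ {4, …, 18, 20}`** for a simple abelian surface `S` and elliptic curves `E_j`
(`t(S) ∈ {3, 4, 7, 11}` plus `3a + b ∈ {1, …, 7, 9}`). [cite: MoonenZarhin1999LowDim, §2 (2.2), §3 and §5 (5.4)] -/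
theorem mtRank_hodge_one_mem_of_isIsogenous_simpleSurface_prod_biproduct_three_curves (hX : IsSmoothProjective n X.X) {S : AbelianVariety ℂ}
    {E : Fin 3 → AbelianVariety ℂ} (hSs : S.IsSimple) (hS2 : S.dim = 2) (hE1 : ∀ j, (E j).dim = 1) (hXP : IsIsogenous X (S.prod (⨁ E))) :
    haveI := BettiUniverse.finite hX 1
    (BettiUniverse.hodge exists_isReal_hodgeModel_holds hX 1).mtRank ∈ ({4, 5, 6, 7, 8, 9, 10, 11, 12, 13, 14, 15, 16, 17, 18, 20} : Finset ℕ) := by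
  have hS := AbelianVariety.isSmoothProjective_holds (A := S)
  haveI := BettiUniverse.finite hX 1
  haveI := BettiUniverse.finite hS 1
  obtain ⟨a, b, h1, hm, ht, -, -⟩ := exists_mtRank_hodge_one_eq_of_isIsogenous_simpleSurface_prod_biproduct_curves (m := 2) hX hSs hS2 hE1 hXP
  simp only [Finset.mem_insert, Finset.mem_singleton]
  rcases mtRank_hodge_one_of_isSimple_surface_sharp hS hSs hS2 with ⟨-, hS11⟩ | ⟨-, hS7⟩ | ⟨-, -, -, hS3⟩ | ⟨-, -, hS4⟩ <;> omega

/-- **`t(S) + 1 ≤ t(S × E₀ × ⋯ × E_m) ≤ t(S) + 3(m+1) ≤ 3m + 14`** for a simple abelian surface and arbitrary elliptic curves.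
[cite: MoonenZarhin1999LowDim, §2 (2.2) and §3] -/
theorem mtRank_hodge_one_le_of_isIsogenous_simpleSurface_prod_biproduct_curves {m : ℕ} (hX : IsSmoothProjective n X.X) {S : AbelianVariety ℂ}
    {E : Fin (m + 1) → AbelianVariety ℂ} (hSs : S.IsSimple) (hS2 : S.dim = 2) (hE1 : ∀ j, (E j).dim = 1) (hXP : IsIsogenous X (S.prod (⨁ E))) :
    haveI := BettiUniverse.finite hX 1
    haveI := BettiUniverse.finite (AbelianVariety.isSmoothProjective_holds (A := S)) 1
    (BettiUniverse.hodge exists_isReal_hodgeModel_holds (AbelianVariety.isSmoothProjective_holds (A := S)) 1).mtRank + 1 ≤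
        (BettiUniverse.hodge exists_isReal_hodgeModel_holds hX 1).mtRank ∧
      (BettiUniverse.hodge exists_isReal_hodgeModel_holds hX 1).mtRank ≤
        (BettiUniverse.hodge exists_isReal_hodgeModel_holds (AbelianVariety.isSmoothProjective_holds (A := S)) 1).mtRank + 3 * (m + 1) ∧
      (BettiUniverse.hodge exists_isReal_hodgeModel_holds hX 1).mtRank ≤ 3 * m + 14 := by
  have hS := AbelianVariety.isSmoothProjective_holds (A := S)
  haveI := BettiUniverse.finite hX 1
  haveI := BettiUniverse.finite hS 1
  obtain ⟨a, b, h1, hm, ht, -, -⟩ := exists_mtRank_hodge_one_eq_of_isIsogenous_simpleSurface_prod_biproduct_curves hX hSs hS2 hE1 hXP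
  rcases mtRank_hodge_one_of_isSimple_surface_sharp hS hSs hS2 with ⟨-, hS11⟩ | ⟨-, hS7⟩ | ⟨-, -, -, hS3⟩ | ⟨-, -, hS4⟩ <;>
    exact ⟨by omega, by omega, by omega⟩

end Summit.HodgeConjecture.CorCM

end
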